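import Mathlib.Combinatorics.SimpleGraph.Clique
import Mathlib.Combinatorics.SimpleGraph.Hamiltonian
import Mathlib.Combinatorics.SimpleGraph.Coloring.Vertex
import Mathlib.Algebra.BigOperators.Group.Finset.Basic
import Literature.Computability.Complexity.BoolEncodings
import Literature.Computability.Complexity.GraphEncodings
import Literature.Computability.Complexity.Classes
import Literature.Computability.Complexity.Nondeterministic
import Literature.Computability.Complexity.Reductions
import HarnessLib

-- provenance: harness21/H21/H21/Statements/PNP/KarpProblems.lean @ ecd7fd8 (interim HEAD d8f2665); M5 mechanical rewrite
/-!
# Karp's 21 problems: seven named NP-complete languages (family PNP)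

Target statement **pnp.S10**: Karp's Main Theorem (1972) — CLIQUE, (undirected) HAMILTON
CIRCUIT, CHROMATIC NUMBER, 3-DIMENSIONAL MATCHING, KNAPSACK, PARTITION and (weighted) MAX CUT are
NP-complete.

For each problem we define a math-level set of yes-instances (e.g.
`cliqueSet ⊆ (Σ n, SimpleGraph (Fin n)) × ℕ`) and push it through a Boolean encoding from the
`CplxCore` prelude (`encodingGraph`, `encodingNatMatrix`, `encodingTriples`,
`encodingListNatBool`, Mathlib's `Computability.encodingNatBool`, paired with
`Computability.Encoding.pairBool`) via `Computability.Encoding.toLanguage`, obtaining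
`CLIQUE HAMCIRCUIT CHROMATIC MAXCUT THREEDM KNAPSACK PARTITION : Language Bool`. One theorem
`isNPComplete_X : IsNPComplete X := by sorry` per problem records Karp's theorem.

## Sources

* R. M. Karp, *Reducibility among combinatorial problems*, in: Complexity of Computer
  Computations, Plenum 1972, §3–§4, Main Theorem (problems 3, 10, 12, 17, 18, 20, 21 of 21).
* M. R. Garey, D. S. Johnson, *Computers and Intractability*, Freeman 1979, §3.1.

## Mathlib anchors and design choices

* CLIQUE uses `SimpleGraph.CliqueFree` (`¬ G.CliqueFree k` iff `G` has a `k`-clique);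
  CHROMATIC NUMBER uses `SimpleGraph.Colorable`; HAMILTON CIRCUIT uses
  `SimpleGraph.IsHamiltonian` (Mathlib, `Combinatorics/SimpleGraph/Hamiltonian.lean`). Mathlib's
  conventions: `G.IsHamiltonian := Fintype.card α ≠ 1 → ∃ a, ∃ p : G.Walk a a,
  p.IsHamiltonianCycle`, so the one-vertex graph (`Fin 1`) IS Hamiltonian
  (`IsHamiltonian.of_card_eq_one`), the empty graph on `Fin 0` is NOT
  (`not_isHamiltonian_of_isEmpty`), and no graph on `Fin 2` is (`not_isHamiltonian_of_card_eq_two`,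
  simple graphs have no 2-cycles). Karp does not discuss these degenerate sizes; they affect
  finitely many instances and hence not NP-completeness.
* MAX CUT is Karp's WEIGHTED version (problem 21: "graph `G`, weighting function
  `w : A → ℤ`, positive integer `W`; is there `S ⊆ N` with `∑_{(u,v) ∈ A, u ∈ S, v ∉ S} w(u,v) ≥ W`").
  Instances are `(Σ n, Fin n → Fin n → ℕ) × ℕ`: an `ℕ`-weight matrix `w` on `Fin n` (weight `0` =
  non-edge) and the target `W`. The cut weight of `S` is `∑ i ∈ S, ∑ j ∈ Sᶜ, w i j`, summed AS
  GIVEN: asymmetric matrices are allowed and each ordered pair `(i, j)` with `i ∈ S`, `j ∉ S`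
  contributes `w i j` once (for a symmetric matrix this is the usual undirected cut weight);
  diagonal entries never contribute.
* 3-DIMENSIONAL MATCHING (problem 17): `U ⊆ T × T × T` with `T = Fin q`, instance
  `Σ q, Finset (Fin q × Fin q × Fin q)`; yes iff some `W ⊆ U` with `|W| = q` has no two distinct
  triples agreeing in any coordinate (`IsThreeDMatching`).
* KNAPSACK is Karp's problem 18, `∑ a_j x_j = b` with `x_j ∈ {0,1}` (i.e. SUBSET SUM): instance
  `List ℕ × ℕ`, yes iff some sublist (`List.Sublist`, which handles repeated entries correctly)
  sums to `b`. PARTITION (problem 20): a list of naturals that splits into two parts of equal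
  sum, stated as: some sublist `l'` has `2 * l'.sum = l.sum`.
* Mathlib has no decision-problem languages for any of these (searched `SubsetSum`, `MaxCut`,
  `NPComplete`, `Knapsack`, `ThreeDMatching`: nothing); the graph-theoretic predicates above are
  used as-is.
* All languages are `noncomputable` (`encodingGraph` is, and `toLanguage` is a set image).

Everything lives in `namespace Literature.PNP` with `open Literature.CplxCore`.
-/

noncomputable section

open Computability Literature.Computability.Complexity

namespace Literature.Computability.Complexity

/-! ### CLIQUE (Karp problem 3) -/

/-- Yes-instances of CLIQUE: pairs `(⟨n, G⟩, k)` such that the graph `G` on `Fin n` has a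
clique of size `k`, i.e. `¬ G.CliqueFree k`. [Karp 1972, §3, problem 3] [cite: Karp1972, §3  problem 3] -/
def cliqueSet : Set ((Σ n, SimpleGraph (Fin n)) × ℕ) :=
  {p | ¬ p.1.2.CliqueFree p.2}

/-- The language CLIQUE over `{0,1}`: encodings `boolPair (code of ⟨n, G⟩) (binary k)` of the
members of `cliqueSet`. [Karp 1972, §3, problem 3] [cite: Karp1972, §3  problem 3] -/
def CLIQUE : Language Bool :=
  (encodingGraph.pairBool encodingNatBool).toLanguage cliqueSet

/-! ### HAMILTON CIRCUIT, undirected (Karp problem 10) -/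

/-- Yes-instances of (undirected) HAMILTON CIRCUIT: finite simple graphs `⟨n, G⟩` on `Fin n`
having a Hamiltonian cycle, via Mathlib's `SimpleGraph.IsHamiltonian`. Conventions inherited from
Mathlib: the graph on `Fin 1` is Hamiltonian, the graph on `Fin 0` and all graphs on `Fin 2` are
not. [Karp 1972, §3, problem 10 (UNDIRECTED HAMILTON CIRCUIT)] [cite: Karp1972, §3  problem 10 (UNDIRECTED HAMILTON CIRC] -/
def hamCircuitSet : Set (Σ n, SimpleGraph (Fin n)) :=
  {G | G.2.IsHamiltonian}

/-- The language HAMILTON CIRCUIT (undirected) over `{0,1}`: encodings of the members of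
`hamCircuitSet` under `encodingGraph`. [Karp 1972, §3, problem 10] [cite: Karp1972, §3  problem 10] -/
def HAMCIRCUIT : Language Bool :=
  encodingGraph.toLanguage hamCircuitSet

/-! ### CHROMATIC NUMBER (Karp problem 12) -/

/-- Yes-instances of CHROMATIC NUMBER: pairs `(⟨n, G⟩, k)` such that `G` is `k`-colourable
(`SimpleGraph.Colorable`). [Karp 1972, §3, problem 12] [cite: Karp1972, §3  problem 12] -/
def chromaticSet : Set ((Σ n, SimpleGraph (Fin n)) × ℕ) :=
  {p | p.1.2.Colorable p.2}

/-- The language CHROMATIC NUMBER over `{0,1}`: encodings `boolPair (code of ⟨n, G⟩) (binary k)`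
of the members of `chromaticSet`. [Karp 1972, §3, problem 12] [cite: Karp1972, §3  problem 12] -/
def CHROMATIC : Language Bool :=
  (encodingGraph.pairBool encodingNatBool).toLanguage chromaticSet

/-! ### MAX CUT, weighted (Karp problem 21) -/

/-- The weight of the cut `(S, Sᶜ)` in the `ℕ`-weighted graph on `Fin n` with weight matrix `w`:
`∑ i ∈ S, ∑ j ∈ Sᶜ, w i j` (ordered pairs from `S` to its complement, entries summed as given;
see the module docstring for the asymmetric case). [Karp 1972, §3, problem 21] [cite: Karp1972, §3  problem 21] -/
def cutWeight {n : ℕ} (w : Fin n → Fin n → ℕ) (S : Finset (Fin n)) : ℕ :=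
  ∑ i ∈ S, ∑ j ∈ Sᶜ, w i j

/-- Yes-instances of weighted MAX CUT: pairs `(⟨n, w⟩, W)` such that some `S ⊆ Fin n` has
`W ≤ cutWeight w S = ∑ i ∈ S, ∑ j ∈ Sᶜ, w i j`. [Karp 1972, §3, problem 21] [cite: Karp1972, §3  problem 21] -/
def maxCutSet : Set ((Σ n, Fin n → Fin n → ℕ) × ℕ) :=
  {p | ∃ S : Finset (Fin p.1.1), p.2 ≤ cutWeight p.1.2 S}

/-- Unfolding lemma: `maxCutSet` in the outline's literal form. [Karp 1972, §3, problem 21] [cite: Karp1972, §3  problem 21] -/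
theorem mem_maxCutSet_iff (p : (Σ n, Fin n → Fin n → ℕ) × ℕ) :
    p ∈ maxCutSet ↔ ∃ S : Finset (Fin p.1.1), p.2 ≤ ∑ i ∈ S, ∑ j ∈ Sᶜ, p.1.2 i j :=
  Iff.rfl

/-- The language (weighted) MAX CUT over `{0,1}`: encodings
`boolPair (code of ⟨n, w⟩) (binary W)` of the members of `maxCutSet`.
[Karp 1972, §3, problem 21] [cite: Karp1972, §3  problem 21] -/
def MAXCUT : Language Bool :=
  (encodingNatMatrix.pairBool encodingNatBool).toLanguage maxCutSet

/-! ### 3-DIMENSIONAL MATCHING (Karp problem 17) -/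

/-- `IsThreeDMatching W`: the set of triples `W` is a (3-dimensional) matching, i.e. no two
distinct elements of `W` agree in any coordinate. [Karp 1972, §3, problem 17;
Garey–Johnson 1979, §3.1.2] [cite: Karp1972, §3  problem 17] -/
def IsThreeDMatching {α β γ : Type} (W : Finset (α × β × γ)) : Prop :=
  ∀ ⦃s⦄, s ∈ W → ∀ ⦃t⦄, t ∈ W → s ≠ t → s.1 ≠ t.1 ∧ s.2.1 ≠ t.2.1 ∧ s.2.2 ≠ t.2.2

/-- Yes-instances of 3-DIMENSIONAL MATCHING: `⟨q, U⟩` with `U ⊆ Fin q × Fin q × Fin q` such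
that some `W ⊆ U` with `|W| = q` is a matching (equivalently, a perfect 3-dimensional matching).
[Karp 1972, §3, problem 17] [cite: Karp1972, §3  problem 17] -/
def threeDMSet : Set (Σ q, Finset (Fin q × Fin q × Fin q)) :=
  {p | ∃ W ⊆ p.2, W.card = p.1 ∧ IsThreeDMatching W}

/-- The language 3DM over `{0,1}`: encodings of the members of `threeDMSet` under
`encodingTriples`. [Karp 1972, §3, problem 17] [cite: Karp1972, §3  problem 17] -/
def THREEDM : Language Bool :=
  encodingTriples.toLanguage threeDMSet

/-! ### KNAPSACK (Karp problem 18) and PARTITION (Karp problem 20) -/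

/-- Yes-instances of Karp's KNAPSACK (`∑ a_j x_j = b`, `x_j ∈ {0,1}`; today called SUBSET SUM):
pairs `(l, b)` such that some sublist of `l` sums to `b`. [Karp 1972, §3, problem 18] [cite: Karp1972, §3  problem 18] -/
def knapsackSet : Set (List ℕ × ℕ) :=
  {p | ∃ l' : List ℕ, l'.Sublist p.1 ∧ l'.sum = p.2}

/-- The language KNAPSACK over `{0,1}`: encodings `boolPair (code of l) (binary b)` of the
members of `knapsackSet`. [Karp 1972, §3, problem 18] [cite: Karp1972, §3  problem 18] -/
def KNAPSACK : Language Bool :=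
  (encodingListNatBool.pairBool encodingNatBool).toLanguage knapsackSet

/-- Yes-instances of PARTITION: lists `l` of naturals admitting a sublist `l'` whose sum is half
of the total, `2 * l'.sum = l.sum` (so `l'` and its complement have equal sums).
[Karp 1972, §3, problem 20] [cite: Karp1972, §3  problem 20] -/
def partitionSet : Set (List ℕ) :=
  {l | ∃ l' : List ℕ, l'.Sublist l ∧ 2 * l'.sum = l.sum}

/-- The language PARTITION over `{0,1}`: encodings of the members of `partitionSet` under
`encodingListNatBool`. [Karp 1972, §3, problem 20] [cite: Karp1972, §3  problem 20] -/
def PARTITION : Language Bool :=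
  encodingListNatBool.toLanguage partitionSet

/-! ### Karp's Main Theorem -/

/-- **pnp.S10** (Karp 1972, Main Theorem, problem 3 of 21). CLIQUE is NP-complete. [cite: Karp1972, Main Theorem  problem 3 of 21] -/
def isNPComplete_CLIQUE : Prop :=
  IsNPComplete CLIQUE

/-- **pnp.S10** (Karp 1972, Main Theorem, problem 10 of 21). Undirected HAMILTON CIRCUIT is
NP-complete. [cite: Karp1972, Main Theorem  problem 10 of 21] -/
def isNPComplete_HAMCIRCUIT : Prop :=
  IsNPComplete HAMCIRCUIT

/-- **pnp.S10** (Karp 1972, Main Theorem, problem 12 of 21). CHROMATIC NUMBER is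
NP-complete. [cite: Karp1972, Main Theorem  problem 12 of 21] -/
def isNPComplete_CHROMATIC : Prop :=
  IsNPComplete CHROMATIC

/-- **pnp.S10** (Karp 1972, Main Theorem, problem 21 of 21). Weighted MAX CUT is
NP-complete. [cite: Karp1972, Main Theorem  problem 21 of 21] -/
def isNPComplete_MAXCUT : Prop :=
  IsNPComplete MAXCUT

/-- **pnp.S10** (Karp 1972, Main Theorem, problem 17 of 21). 3-DIMENSIONAL MATCHING is
NP-complete. [cite: Karp1972, Main Theorem  problem 17 of 21] -/
def isNPComplete_THREEDM : Prop :=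
  IsNPComplete THREEDM

/-- **pnp.S10** (Karp 1972, Main Theorem, problem 18 of 21). KNAPSACK (in Karp's 0/1 equality
form, i.e. SUBSET SUM) is NP-complete. [cite: Karp1972, Main Theorem  problem 18 of 21] -/
def isNPComplete_KNAPSACK : Prop :=
  IsNPComplete KNAPSACK

/-- **pnp.S10** (Karp 1972, Main Theorem, problem 20 of 21). PARTITION is NP-complete. [cite: Karp1972, Main Theorem  problem 20 of 21] -/
def isNPComplete_PARTITION : Prop :=
  IsNPComplete PARTITION

end Literature.Computability.Complexity

end
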